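import Mathlib
import Summits.NavierStokesRegularity.NavierStokesRegularity.Theorems.EulerZoomLiouvillePowerGaugeEulerLiouvilleCasimirHaulMember
import Summits.NavierStokesRegularity.NavierStokesRegularity.Theorems.EulerZoomLiouvillePowerGaugeEulerLiouvilleCasimirHaulHaulingInequality
import Summits.NavierStokesRegularity.NavierStokesRegularity.Theorems.EulerZoomLiouvillePowerGaugeEulerLiouvilleClassIsometryTransport
import HarnessLib

/-!
# Crux `EulerZoomLiouville.PowerGaugeEulerLiouville` (stmt-NavierStokesRegularity-19832), width sub-line `casimir_haul` (ns-idea-11):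
# THE CASIMIR MEMBER ABOUT ANY AXIS (KEY W1-AX2 of the LEAD ns-typeII-p2 g16; width seat ns-ezl-w1 g10)

Route №10 `EulerZoomLiouville` (NavierStokesRegularity), crux E = stmt-NavierStokesRegularity-19832.

The casimir member `CasimirHaul.slabBoundedSwirlFree_trivial_of_haulingInequality` (ns-sfl-p1 g10, p717224: H1 ledger flows ∘ H4a travel ∘ H4c book ∘
H4 race (ns-ezl-w3) ∘ the LEAD's `PastIrrotational` endgame) fed with H3 `CasimirHaul.haulingInequality` (ns-ezl-w2 g7, p717413) empties the classical
axisymmetric swirl-free slab-bounded stratum of the crux class about the FIXED `x₃`-axis (`IsAxisymmetric`, `HasNoSwirl` are typed about `e₃`).  Seregin's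
class is `O(3)`-invariant (`ClassIsometry.ae_eq_zero_of_conj`, this seat, over ns-ezl-w2 g3's `…ClassIsometry`), so the same stratum about ANY axis
through the blow-up point is empty:

* ★ `CasimirHaul.slabBoundedSwirlFree_trivial_anyAxis (hρ) (hρ2) (hcls) (R) (hs')` — for a member `(u, p, H, c)` of the class (`InClass` unfolded,
  `0 < ρ ≤ ½`) and a linear isometry `R` of `ℝ³`, if the CONJUGATED pair `u′ = (τ, x) ↦ R u(τ, R⁻¹ x)`, `p′ = (τ, x) ↦ p(τ, R⁻¹ x)` lies in the haulable
  stratum (`IsSlabBoundedSwirlFree u′ p′` unfolded: classical Euler on the open past, axisymmetric swirl-free slices, velocity bounded on compact past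
  slabs) — i.e. `u` itself is classical, slab-bounded and axisymmetric swirl-free about the axis `R⁻¹(ℝ e₃)` — then `u = 0` a.e. on the past slab.

WHAT THIS IS NOT: not NS, not E, not the crux: a widening (fixed axis → any axis) of an already killed classical stratum of `stub_nonSelfSimilarRest`;
the wall H6 of the sub-line and the crux E stay OPEN; no summit statement is proved by this file.
[cite: CaffarelliKohnNirenberg1982, §2; MajdaBertozziCUP2002, §1.2 Prop. 1.1 (iii), §2.3.3]
-/

noncomputable section

-- flat `Theorems/<Route><Decl>…` files of one crux share the namespace of the crux (tree convention)
set_option linter.dupNamespace false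

open MeasureTheory Set Filter Topology Metric Function
open scoped NNReal ENNReal

namespace Summit.NavierStokesRegularity.NavierStokesRegularity.Theorems.PowerGaugeEulerLiouville.CasimirHaul

open Literature.Analysis Literature.Analysis.FluidPDE
open Summit.NavierStokesRegularity.NavierStokesRegularity.Theorems.PowerGaugeEulerLiouville

/-- ★ **THE CASIMIR MEMBER ABOUT ANY AXIS** (every `0 < ρ ≤ ½`): a member `(u, p, H, c)` of the crux class (`InClass` δ-unfolded) such that, for some
linear isometry `R` of `ℝ³`, the conjugated pair `u′ = (τ, x) ↦ R u(τ, R⁻¹ x)`, `p′ = (τ, x) ↦ p(τ, R⁻¹ x)` is classical on the open past with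
axisymmetric swirl-free slices and velocity bounded on compact past slabs (`IsSlabBoundedSwirlFree u′ p′` δ-unfolded, the conjugated fields written
literally), satisfies `u = 0` a.e. on `(−∞,0) × ℝ³`.  Proof: `ClassIsometry.ae_eq_zero_of_conj` transports the class binders to the conjugated member,
which `slabBoundedSwirlFree_trivial_of_haulingInequality haulingInequality` kills.
[cite: CaffarelliKohnNirenberg1982, §2; MajdaBertozziCUP2002, §2.3.3] -/
theorem slabBoundedSwirlFree_trivial_anyAxis
    {ρ : ℝ} (hρ : 0 < ρ) (hρ2 : ρ ≤ 1 / 2)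
    {u : ℝ → EuclideanSpace ℝ (Fin 3) → EuclideanSpace ℝ (Fin 3)} {p : ℝ → EuclideanSpace ℝ (Fin 3) → ℝ}
    {H : ℝ → EuclideanSpace ℝ (Fin 3) → EuclideanSpace ℝ (Fin 3) →L[ℝ] EuclideanSpace ℝ (Fin 3)} {c : ℝ≥0}
    (hcls : IsSuitableWeakSolutionOn (slab (EuclideanSpace ℝ (Fin 3)) (Set.Iio 0) isOpen_Iio) 0 0 u p ∧
      HasWeakSpatialGradientOn (slab (EuclideanSpace ℝ (Fin 3)) (Set.Iio 0) isOpen_Iio) u H ∧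
      (∀ a : ℝ, 0 < a →
        ENNReal.ofReal (a ^ (2 * ρ)) * cknA a (0 : ℝ × EuclideanSpace ℝ (Fin 3)) u +
            ENNReal.ofReal (a ^ ρ) * cknE a (0 : ℝ × EuclideanSpace ℝ (Fin 3)) H +
          ENNReal.ofReal (a ^ (2 * ρ)) * cknD a (0 : ℝ × EuclideanSpace ℝ (Fin 3)) p ≤ (c : ℝ≥0∞)))
    (R : EuclideanSpace ℝ (Fin 3) ≃ₗᵢ[ℝ] EuclideanSpace ℝ (Fin 3))
    (hs' : IsClassicalEulerSolutionOn (Set.Iio 0) 0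
        (fun τ x => R (u τ (R.symm x))) (fun τ x => p τ (R.symm x)) ∧
      (∀ τ : ℝ, τ < 0 →
        IsAxisymmetric ((fun τ x => R (u τ (R.symm x))) τ) ∧ HasNoSwirl ((fun τ x => R (u τ (R.symm x))) τ)) ∧
      (∀ T₁ T₀ : ℝ, T₁ ≤ T₀ → T₀ < 0 → ∃ B : ℝ, ∀ τ ∈ Set.Icc T₁ T₀, ∀ x : EuclideanSpace ℝ (Fin 3),
        ‖(fun τ x => R (u τ (R.symm x))) τ x‖ ≤ B)) :
    Function.uncurry u =ᵐ[volume.restrict (Set.Iio (0 : ℝ) ×ˢ (Set.univ : Set (EuclideanSpace ℝ (Fin 3))))] 0 := by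
  -- transport the class binders to the conjugated member (this seat's `ClassIsometry.ae_eq_zero_of_conj`), then kill it by the fixed-axis member
  refine ClassIsometry.ae_eq_zero_of_conj hcls.1 hcls.2.1 hcls.2.2 R ?_
  intro u' p' H' hsw' hH' hg' hu' hp'
  subst hu' hp'
  exact slabBoundedSwirlFree_trivial_of_haulingInequality haulingInequality hρ hρ2 ⟨hsw', hH', hg'⟩ hs'

end Summit.NavierStokesRegularity.NavierStokesRegularity.Theorems.PowerGaugeEulerLiouville.CasimirHaul

end
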